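import Mathlib
import HarnessLib
import Summits.Ventures.LatticeQCDFlow.Exactness.U1ExactForceWilson

/-!
# `U(1)` rung: the engine's LO Wilson-flow sub-step IS the HMC drift `V_e ← e^(icp_e) V_e` at momentum `p = −(ε/(βc²κ))·(exact gradient force of β·S_W)` — one explicit Euler step of the gradient flow of `S_W`

HONEST FRAMING: exact (Metropolis-corrected) sampling algorithms for lattice gauge theory;
figures of merit are autocorrelation/cost numbers at stated couplings and volumes; no
continuum-physics claim.

Venture `LatticeQCDFlow` (cell pub-lqcd), topic `Exactness`; FANOUT row 14 (`eng-flowhmc`, `U(1)`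
rung; member `maps.u1_wilson_flow_lo`: `V(x,μ) ↦ V(x,μ)·e^(iεZ_(x,μ))`, `Z` the LO flow field; drift
`V_e ← e^(icp_e) V_e`).  NEW WORK of the cell; nothing is cited as a fact; no number.  The abelian twin
of `SU2WilsonFlowLOGradientStep`, immediate from `U1ExactForceWilson.u1ExactForce_wilson`
(`κ·∇ = −(βcκ)·Z`):

* **`u1Substep_eq_circleDrift_exactForce`** — for `L ≥ 2`, `β c κ ≠ 0`, every field `V`, link `e` and
  step `ε`: the sub-step factor `V_e · e^(iεZ_e(V))` (formula VERBATIM as in `exists_layers_u1WilsonFlowLO`)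
  equals the drift `e^(icp_e) · V_e` at `p = −(ε/(βc²κ)) · (κ·∇_p (β S_W(e^(icp)·V)))(0)` — the
  zero-parameter member moves every active link by one explicit Euler step of size `ε` DOWN the
  gradient of `S_W` (Lüscher's `V̇ = −∂S·V` on the `U(1)` rung, in the engine's coordinates).

NOT CLAIMED: the masked/frozen-field bookkeeping of a whole sub-step (the identity is per link, for
the field the sub-step reads); `L = 1`; any number.
-/

noncomputable section

namespace Summit.Ventures.LatticeQCDFlow.Exactness

open MeasureTheory
open Literature.MathematicalPhysics.QuantumFieldTheory Literature.MathematicalPhysics.QuantumLattice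

variable {d L : ℕ} [NeZero L]

/-- **The `U(1)` LO Wilson-flow sub-step factor is the HMC drift at momentum
`−(ε/(βc²κ))·(exact-gradient force of β·S_W)`** (see the module docstring). -/
theorem u1Substep_eq_circleDrift_exactForce (hL : 2 ≤ L) {β c κ : ℝ} (hβ : β ≠ 0) (hc : c ≠ 0)
    (hκ : κ ≠ 0) (ε : ℝ) (V : GaugeConfig d L Circle) (e : Edge d L) :
    V e * Circle.exp (ε * ∑ ν ∈ Finset.univ.erase e.2,
            (((plaquetteHolonomy V (e.1 - Pi.single ν 1) e.2 ν : Circle) : ℂ).im -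
              ((plaquetteHolonomy V e.1 e.2 ν : Circle) : ℂ).im)) =
      Circle.exp (c * (-(ε / (β * c ^ 2 * κ)) * (fun i : Edge d L => κ * fderiv ℝ (fun p : (Edge d L → ℝ) => (fun W : GaugeConfig d L Circle => β * wilsonAction u1Rep W) ((fun i : Edge d L => Circle.exp (c * p i)) * V)) 0 (Pi.single i 1)) e)) * V e := by
  rw [u1ExactForce_wilson hL β c κ V, mul_comm (V e)]
  congr 2
  beta_reduce
  field_simp

end Summit.Ventures.LatticeQCDFlow.Exactness
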